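import Mathlib
import HarnessLib
import Summits.HubbardSuperconductivity.HubbardSuperconductivity.Theses.KLProgramme
import Summits.HubbardSuperconductivity.HubbardSuperconductivity.Theorems.KLProgrammeKLRegimeEngineV8DefsU12bGQ
import Summits.HubbardSuperconductivity.HubbardSuperconductivity.Theorems.KLProgrammeKLRegimeEngineV8DefsQ9dG
import Summits.HubbardSuperconductivity.HubbardSuperconductivity.Theorems.KLProgrammeKLRegimeEngineV8DefsG14
import Summits.HubbardSuperconductivity.HubbardSuperconductivity.Theorems.KLProgrammeKLRegimeEngineV17F2ClosersG
import Summits.HubbardSuperconductivity.HubbardSuperconductivity.Theorems.KLProgrammeKLRegimeEngineScaleZeroV17FRaiseGeo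
import Summits.HubbardSuperconductivity.HubbardSuperconductivity.Theorems.KLProgrammeKLRegimeEngineTwoLegStepV17F2ZeroCloserRaise
import Summits.HubbardSuperconductivity.HubbardSuperconductivity.Theorems.KLProgrammeKLRegimeEngineV8IsoMomentRow
import Summits.HubbardSuperconductivity.HubbardSuperconductivity.Theorems.KLProgrammeKLRegimeEngineScaleZeroLevelZeroFrame
import Summits.HubbardSuperconductivity.HubbardSuperconductivity.Theorems.KLProgrammeKLRegimeEngineKernelNormsWt4
import Summits.HubbardSuperconductivity.HubbardSuperconductivity.Theorems.KLProgrammeKLRegimeSplitFlowPieceOscDefs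
import Summits.HubbardSuperconductivity.HubbardSuperconductivity.Theorems.KLProgrammeKLRegimeTwoLegReadOscConsts

/-!
# K3 ENGINE (stmt-HubbardSuperconductivity-20437 `KLRegimeEngineV17F2`): the (a)/(M) CLOSERS and the (b) CLOSER-MODULO-PRODUCERS AT `(G, klEngQ9dG G P R)` — registrant PRESTAGE
# for the option of folding the token-#13 motion (α1) «(ℓ)-CE-CAP» into «A24∪A25» (plan g24 (R269)(C): G := `klEngGeo14` elect; word asked of p1b);
# cell gate-hubbard-kl, seat gate-hubbard-kl-p1b g16 (20437 v2 registrant lineage)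

WHAT.  The twins of `…EngineV17F2ClosersG` (p665440) at the (α1) tokens: package `Q := klEngQ9dG G P R` (…DefsQ9dG: `CE` absorbs the UNCAPPED core constant
`klTowerCoreCECG G P R`), doors `klEngC₃7GU G P R` / `klEngU₀12GQ G (klEngQ9dG G P R) P R c` (…DefsU12bGQ):
* §1 **`stub_engine_scale0_GQd`** / **`stub_twoLeg_scale0_GQd`** — stubs (a)/(M) at `(G, klEngQ9dG G P R)` for any admissible `G` (the raise-generic closers
  `stub_engine_scale0_geo_of_klEng8 … (fun P R => klEngQ9dG G P R) (isRaiseOf_klEngQ9dG_family G)` / `stub_twoLeg_scale0_raise_G … (isRaiseOf_klEngQ9dG G P R)` ∘ the chain heads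
  `klEngC₃7GU_le_klEngC₃6` / `klEngU₀12GQ_le_klEngU₀10`);
* §2 **`stub_engine_step_norms_of_producers_GQd G hG hexT hexI hexG`** — stub (b) at `(G, klEngQ9dG G P R)` from the three producers' ∃-statements AT `G`, the tower one now
  UNCAPPED (`∃ e, IsTowerPkgC e ∧ TowerCoreStepV2 G P R (klEngQ8 P R) …` — NO `e.1 ≤ …` conjunct): p662084's composition with `towerCoreCG_at (isRaiseOf_klEngQ9dG_klEngQ8 G P R)
  (klTowerCoreCECG_le_klEngQ9dG_CE G P R)` in place of `towerCoreC9_at_klEngQ9c`;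
* §3 instances in **`…EngineV8.A24a1G14`**: `stub_engine_scale0` / `stub_twoLeg_scale0` = rows (a)/(M) of the rev 15-A24∪α1-G14 CANDIDATE image 521673369341bb00 verbatim.
NOT A MOTION and NOT a stub credit: nothing registered at these tokens; producer statements are HYPOTHESES.  Bookkeeping compositions; nothing about the model is asserted;
nothing asserts (b), any open stub of 20437, (ℓ)'s constant, K3 or superconductivity.
-/

noncomputable section

namespace Summit.HubbardSuperconductivity.HubbardSuperconductivity.Theorems.EngineV8

set_option linter.dupNamespace false -- summit = problem name (single-conjunct summit), D-0017

open Real Finset Literature.MathematicalPhysics.QuantumLattice Literature.Probability.LatticeModels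
open Summit.HubbardSuperconductivity.HubbardSuperconductivity.Theorems.KLRegimeSplit
open Summit.HubbardSuperconductivity.HubbardSuperconductivity.Theorems.KLProgrammeLegKernels
open Summit.HubbardSuperconductivity.HubbardSuperconductivity.Theorems.DispersionFlow

/-! ## §1 Stubs (a)/(M) at `(G, klEngQ9dG G P R)` -/

/-- **STUB (a) AT `(G, klEngQ9dG G P R)`** for any `G` with `initDevBar G = initDevBar klEngGeo8`, `klEngGeo8.cE4 ≤ G.cE4`, `klEngGeo8.CF ≤ G.CF`. -/
theorem stub_engine_scale0_GQd (G : GeoConsts) (hID : ∀ U : ℝ, initDevBar G U = initDevBar klEngGeo8 U) (hE4 : klEngGeo8.cE4 ≤ G.cE4)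
    (hCF : klEngGeo8.CF ≤ G.CF) :
    ∀ (P : SplitConsts) (R : RenConsts) (c : ℝ), P.WF → R.WF2 → 0 < c → c ≤ klEngC₃7GU G P R →
      ∀ μ ∈ klWindowC, ∀ U : ℝ, 0 < U → U ≤ klEngU₀12GQ G (klEngQ9dG G P R) P R c → ∀ β : ℝ, klBetaMin ≤ β → β ≤ Real.exp (c / U ^ 2) →
        ∀ (L M : ℕ) [NeZero L] [NeZero M], klEngL₄ P R β U ≤ L → klEngM₃ β U L ≤ M →
          FrameOK R U (nScales β) μ (klFlowFrameU L M β U μ 0) →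
            KernelNormsV4 L M P (klEngQ9dG G P R) β U μ (klFlowFrameU L M β U μ 0) 0 ∧
              PairLadderStepAtV17F2 L M G P (klEngQ9dG G P R) β U μ 0 ∧
                QuarticValueUVAtV17F L M G P (klEngQ9dG G P R) β U μ 0 ∧
                  EngineFirstMoments L M G P (klEngQ9dG G P R) β U μ (klFlowFrameU L M β U μ 0) 0 ∧
                    IsoTupleL1AtV17F L M G P β U μ 0 :=
  fun P R c hP hR hc hc3 μ hμ U hU hUle β hβ hβc L M _ _ hL hM hfr =>
    stub_engine_scale0_geo_of_klEng8 G hID hE4 hCF (fun P R => klEngQ9dG G P R) (isRaiseOf_klEngQ9dG_family G) P R c hP hR hc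
      (hc3.trans (klEngC₃7GU_le_klEngC₃6 G P R)) μ hμ U hU (hUle.trans (klEngU₀12GQ_le_klEngU₀10 G _ P R c)) β hβ hβc L M hL hM hfr

/-- **STUB (M) AT `(G, klEngQ9dG G P R)`** for any `G` whose jet table dominates `klC4aJetC2`. -/
theorem stub_twoLeg_scale0_GQd (G : GeoConsts) (hS : ∀ k, klC4aJetC2 k ≤ G.S k) :
    ∀ (P : SplitConsts) (R : RenConsts) (c : ℝ), P.WF → R.WF2 → 0 < c → c ≤ klEngC₃7GU G P R →
      ∀ μ ∈ klWindowC, ∀ U : ℝ, 0 < U → U ≤ klEngU₀12GQ G (klEngQ9dG G P R) P R c → ∀ β : ℝ, klBetaMin ≤ β → β ≤ Real.exp (c / U ^ 2) →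
        ∀ (L M : ℕ) [NeZero L] [NeZero M], klEngL₄ P R β U ≤ L → klEngM₃ β U L ≤ M →
          FrameOK R U (nScales β) μ (klFlowFrameU L M β U μ 0) →
            EngineBoundsAtV17F2 L M G P (klEngQ9dG G P R) β U μ 0 →
              TwoLegReadJetBound L M klC4aJetC2 (klC4aJetC' P R) β U μ (klFlowFrameU L M β U μ 0) 0 →
                TwoLegStepV17F2 L M G P (klEngQ9dG G P R) R β U μ 0 :=
  fun P R c hP hR hc hc3 μ hμ U hU hUle β hβ hβc L M _ _ hL hM hfr hE hJ =>
    stub_twoLeg_scale0_raise_G G P R (klEngQ9dG G P R) (isRaiseOf_klEngQ9dG G P R) klC4aJetC2 hS c hP hR hc (hc3.trans (klEngC₃7GU_le_klEngC₃6 G P R)) μ hμ U hU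
      (hUle.trans (klEngU₀12GQ_le_klEngU₀10 G _ P R c)) β hβ hβc L M hL hM hfr hE hJ

/-! ## §2 Stub (b) at `(G, klEngQ9dG G P R)` from its three producers' ∃-statements AT `G` (tower UNCAPPED) -/

/-- **STUB (b) AT `(G, klEngQ9dG G P R)` FROM ITS THREE PRODUCERS' ∃-STATEMENTS, THE TOWER ONE UNCAPPED** (p662084's composition; the CE-joint is
`klTowerCoreCECG_le_klEngQ9dG_CE`, i.e. discharged by the token, not by a cap on the producer). -/
theorem stub_engine_step_norms_of_producers_GQd (G : GeoConsts) (hG : G.WF)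
    (hexT : ∀ (P : SplitConsts) (R : RenConsts), P.WF → R.WF2 →
      ∃ e : ℝ × (EngConsts → ℝ → ℝ) × ℝ, IsTowerPkgC e ∧ TowerCoreStepV2 G P R (klEngQ8 P R) e.1 e.2.1 e.2.2)
    (hexI : ∃ Edu : ℝ × (SplitConsts → RenConsts → ℝ) × (GeoConsts → SplitConsts → RenConsts → EngConsts → ℝ → ℝ),
      0 ≤ Edu.1 ∧ (∀ P R, 0 ≤ Edu.2.1 P R) ∧ (∀ G P R Q cc, 0 < Edu.2.2 G P R Q cc) ∧ IsoMomFlowAt Edu.1 Edu.2.1 Edu.2.2)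
    (hexG : ∀ (P : SplitConsts) (R : RenConsts), P.WF → R.WF2 →
      ∃ e : (ℝ × ℝ × ℝ) × (EngConsts → ℝ → ℝ) × ℝ, IsGridLitPkg R e ∧ TwoLegGridMomentsStepCT P R (klEngQ7 P R) G e.1 e.2.1 e.2.2) :
    ∀ (P : SplitConsts) (R : RenConsts) (c : ℝ), P.WF → R.WF2 → 0 < c → c ≤ klEngC₃7GU G P R →
      ∀ μ ∈ klWindowC, ∀ U : ℝ, 0 < U → U ≤ klEngU₀12GQ G (klEngQ9dG G P R) P R c → ∀ β : ℝ, klBetaMin ≤ β → β ≤ Real.exp (c / U ^ 2) →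
        ∀ (L M : ℕ) [NeZero L] [NeZero M], klEngL₄ P R β U ≤ L → klEngM₃ β U L ≤ M →
          ∀ n : ℕ, 1 ≤ n → n ≤ nScales β + 1 → IsKLRegime U c (-(n : ℤ)) →
            HistP klPredsV17F2 L M G P (klEngQ9dG G P R) R β U μ 0 n →
              (∀ m, 1 ≤ m → m < n → FlowPieceOscAt L M (klReadOscC P R) β U μ m) →
              FrameOK R U (nScales β) μ (klFlowFrameU L M β U μ n) →
                (∀ j ≤ n, LevelsUExportMixedAt L M (klCU2 P R (klEngQ7 P R)) P β U μ j) →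
                  KernelNormsV4 L M P (klEngQ9dG G P R) β U μ (klFlowFrameU L M β U μ n) n ∧
                    (∀ j ≤ n, (KernelNormsLevels L M P (klEngQ9dG G P R) β U μ (klFlowFrameU L M β U μ n) j ∧
                      KernelNormsWt4 L M (klWtBudget P (klEngQ9dG G P R) U j) β U μ (klFlowFrameU L M β U μ n) j)) ∧
                    EngineFirstMoments L M G P (klEngQ9dG G P R) β U μ (klFlowFrameU L M β U μ n) n ∧
                    IsoFirstMomentsAt L M klIsoMomC (klIsoMomD P R) P β U μ n ∧
                    TwoLegGridFlowMomentsAtC L M (klZtG G P R) (klZs1G G P R) (klZs2G G P R) c β U μ n := by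
  intro P R c hP hR hc hc3 μ hμ U hU hUle β hβ hβc L M _ _ hL hM n hn1 hn hreg hhist hosc hfr hlevU
  have hc36 : c ≤ klEngC₃6 P R := hc3.trans (klEngC₃7GU_le_klEngC₃6 G P R)
  have hU10 : U ≤ klEngU₀10 P R c := hUle.trans (klEngU₀12GQ_le_klEngU₀10 G _ P R c)
  have hβ0 : 0 ≤ β := le_trans (by norm_num [klBetaMin]) hβ
  -- tower core at (G, klEngQ9dG G P R): levels `1 ≤ j ≤ n` and first moments (…TowerCoreDefsCGU §2; CE-joint by the token row)
  obtain ⟨hlev1, hE4⟩ := towerCoreCG_at (hexT P R hP hR) (isRaiseOf_klEngQ9dG_klEngQ8 G P R) (klTowerCoreCECG_le_klEngQ9dG_CE G P R) hc hc36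
    (hc3.trans (klEngC₃7GU_le_klTowerCoreCCG G P R)) hμ hU hU10 (hUle.trans (klEngU₀12GQ_le_klTowerCoreUCG G _ P R c)) hβ hβc hL hM hn1 hn hreg hhist hosc hfr hlevU
  -- level `j = 0` at `K_n` from the scale-0 rung, conjunct 1 from the weighted bundle at `j = n`
  have h0 := levelZero_norms_frame_of_isRaiseOf_U10L4 P R (klEngQ9dG G P R) (isRaiseOf_klEngQ9dG G P R) c hP hR hc hc36 μ hμ U hU hU10 β hβ hβc
    (klFlowFrameU L M β U μ n) hfr L M hL hM
  have hlev : ∀ j ≤ n, KernelNormsLevels L M P (klEngQ9dG G P R) β U μ (klFlowFrameU L M β U μ n) j ∧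
      KernelNormsWt4 L M (klWtBudget P (klEngQ9dG G P R) U j) β U μ (klFlowFrameU L M β U μ n) j := by
    intro j hj
    rcases Nat.eq_zero_or_pos j with rfl | hj1
    · exact ⟨h0.2.1, h0.2.2⟩
    · exact hlev1 j hj1 hj
  have hV4 : KernelNormsV4 L M P (klEngQ9dG G P R) β U μ (klFlowFrameU L M β U μ n) n :=
    kernelNormsV4_of_kernelNormsWt4_klWtBudget hβ0 (hlev n le_rfl).2
  -- conjunct 4: the iso-moment row from W3's witness through the deferred package, at (G, klEngQ9dG G P R)
  obtain ⟨⟨E, d, u⟩, hE0, hd, hu, hE⟩ := hexI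
  have hiso := isoFirstMomentsAt_flow_klIsoMomPack hE0 hd hu hE G hG P R (klEngQ9dG G P R) c hP hR (klEngQ9dG_wf G P R) hc hc36 μ hμ
    U hU (hUle.trans (klEngU₀12GQ_le_klIsoMomU G _ P R c)) β hβ hβc L M hL hM n hn1 hn hreg hhist hfr
  -- conjunct 5: the grid C-atom from the deferred grid-literal producer at G
  have hgrid := twoLegGridFlowMomentsAtC_klZG_of_exists (hexG P R hP hR) (isRaiseOf_klEngQ9dG G P R) hc hc36 (hc3.trans (klEngC₃7GU_le_klGridLitCAtG G P R)) hμ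
    hU hU10 (hUle.trans (klEngU₀12GQ_le_klGridLitUAtG G _ P R c)) hβ hβc hL hM hn1 hn hhist hfr hV4 hlev hlevU
  exact ⟨hV4, hlev, hE4, hiso, hgrid⟩

end Summit.HubbardSuperconductivity.HubbardSuperconductivity.Theorems.EngineV8

/-! ### rev 15-A24∪α1 CANDIDATE «klEngGeo14, klEngQ9dG klEngGeo14» (image 521673369341bb00): rows (a)/(M) verbatim -/

namespace Summit.HubbardSuperconductivity.HubbardSuperconductivity.Theorems.EngineV8.A24a1G14

set_option linter.dupNamespace false -- summit = problem name (single-conjunct summit), D-0017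

open Real Finset Literature.MathematicalPhysics.QuantumLattice Literature.Probability.LatticeModels
open Summit.HubbardSuperconductivity.HubbardSuperconductivity.Theorems.KLRegimeSplit
open Summit.HubbardSuperconductivity.HubbardSuperconductivity.Theorems.KLProgrammeLegKernels
open Summit.HubbardSuperconductivity.HubbardSuperconductivity.Theorems.DispersionFlow
open Summit.HubbardSuperconductivity.HubbardSuperconductivity.Theorems.EngineV8

/-- Candidate stub (a) at `(klEngGeo14, klEngQ9dG klEngGeo14 P R)`, by `stub_engine_scale0_GQd`. -/
theorem stub_engine_scale0 :
    ∀ (P : SplitConsts) (R : RenConsts) (c : ℝ), P.WF → R.WF2 → 0 < c → c ≤ klEngC₃7GU klEngGeo14 P R →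
      ∀ μ ∈ klWindowC, ∀ U : ℝ, 0 < U → U ≤ klEngU₀12GQ klEngGeo14 (klEngQ9dG klEngGeo14 P R) P R c → ∀ β : ℝ, klBetaMin ≤ β → β ≤ Real.exp (c / U ^ 2) →
        ∀ (L M : ℕ) [NeZero L] [NeZero M], klEngL₄ P R β U ≤ L → klEngM₃ β U L ≤ M →
          FrameOK R U (nScales β) μ (klFlowFrameU L M β U μ 0) →
            KernelNormsV4 L M P (klEngQ9dG klEngGeo14 P R) β U μ (klFlowFrameU L M β U μ 0) 0 ∧
              PairLadderStepAtV17F2 L M klEngGeo14 P (klEngQ9dG klEngGeo14 P R) β U μ 0 ∧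
                QuarticValueUVAtV17F L M klEngGeo14 P (klEngQ9dG klEngGeo14 P R) β U μ 0 ∧
                  EngineFirstMoments L M klEngGeo14 P (klEngQ9dG klEngGeo14 P R) β U μ (klFlowFrameU L M β U μ 0) 0 ∧
                    IsoTupleL1AtV17F L M klEngGeo14 P β U μ 0 :=
  stub_engine_scale0_GQd klEngGeo14 initDevBar_klEngGeo14 klEngGeo8_cE4_le_klEngGeo14_cE4 klEngGeo8_CF_le_klEngGeo14_CF

/-- Candidate stub (M) at `(klEngGeo14, klEngQ9dG klEngGeo14 P R)`, by `stub_twoLeg_scale0_GQd`. -/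
theorem stub_twoLeg_scale0 :
    ∀ (P : SplitConsts) (R : RenConsts) (c : ℝ), P.WF → R.WF2 → 0 < c → c ≤ klEngC₃7GU klEngGeo14 P R →
      ∀ μ ∈ klWindowC, ∀ U : ℝ, 0 < U → U ≤ klEngU₀12GQ klEngGeo14 (klEngQ9dG klEngGeo14 P R) P R c → ∀ β : ℝ, klBetaMin ≤ β → β ≤ Real.exp (c / U ^ 2) →
        ∀ (L M : ℕ) [NeZero L] [NeZero M], klEngL₄ P R β U ≤ L → klEngM₃ β U L ≤ M →
          FrameOK R U (nScales β) μ (klFlowFrameU L M β U μ 0) →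
            EngineBoundsAtV17F2 L M klEngGeo14 P (klEngQ9dG klEngGeo14 P R) β U μ 0 →
              TwoLegReadJetBound L M klC4aJetC2 (klC4aJetC' P R) β U μ (klFlowFrameU L M β U μ 0) 0 →
                TwoLegStepV17F2 L M klEngGeo14 P (klEngQ9dG klEngGeo14 P R) R β U μ 0 :=
  stub_twoLeg_scale0_GQd klEngGeo14 klC4aJetC2_le_klEngGeo14_S

end Summit.HubbardSuperconductivity.HubbardSuperconductivity.Theorems.EngineV8.A24a1G14

/-! ### rev-16 V2 (α1) REGISTRATION «A24∪A25∪Z∪α1»-G14 (image `engine-flow-v2x.r16-A24A25Za1-G14.lean` 27cd7ed0f55f17c0): stub (b) from its producers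

Registrant re-stamp (p1b g17, 2026-08-29; pen g26 (R394)(E)/(R399), RULE-REG-2 — the p692663 precedent): the file above is the landed helper
p707322 byte-for-byte; this resubmission WITHOUT `--as helper` appends the (b) instance below and lets the gate record §3's
`A24a1G14.stub_engine_scale0` / `A24a1G14.stub_twoLeg_scale0` (rows adc3f400a1f9 / 0c6f707d75f2 of the V2 registration) as the (a)/(M) STUB CREDITS. -/

namespace Summit.HubbardSuperconductivity.HubbardSuperconductivity.Theorems.EngineV8.A24a1G14

set_option linter.dupNamespace false -- summit = problem name (single-conjunct summit), D-0017

open Real Finset Literature.MathematicalPhysics.QuantumLattice Literature.Probability.LatticeModels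
open Summit.HubbardSuperconductivity.HubbardSuperconductivity.Theorems.KLRegimeSplit
open Summit.HubbardSuperconductivity.HubbardSuperconductivity.Theorems.KLProgrammeLegKernels
open Summit.HubbardSuperconductivity.HubbardSuperconductivity.Theorems.DispersionFlow
open Summit.HubbardSuperconductivity.HubbardSuperconductivity.Theorems.EngineV8

/-- **STUB (b) OF THE rev-16 V2 (α1) REGISTRATION (row e78dfb33d2f7) FROM ITS THREE PRODUCERS' ∃-STATEMENTS AT `klEngGeo14`, THE TOWER ONE
UNCAPPED** (hypotheses; no CE cap on `e.1` — the point of the α1 token `klEngQ9dG`): `stub_engine_step_norms_of_producers_GQd klEngGeo14 klEngGeo14_wf`. -/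
theorem stub_engine_step_norms_of_producers
    (hexT : ∀ (P : SplitConsts) (R : RenConsts), P.WF → R.WF2 →
      ∃ e : ℝ × (EngConsts → ℝ → ℝ) × ℝ, IsTowerPkgC e ∧ TowerCoreStepV2 klEngGeo14 P R (klEngQ8 P R) e.1 e.2.1 e.2.2)
    (hexI : ∃ Edu : ℝ × (SplitConsts → RenConsts → ℝ) × (GeoConsts → SplitConsts → RenConsts → EngConsts → ℝ → ℝ),
      0 ≤ Edu.1 ∧ (∀ P R, 0 ≤ Edu.2.1 P R) ∧ (∀ G P R Q cc, 0 < Edu.2.2 G P R Q cc) ∧ IsoMomFlowAt Edu.1 Edu.2.1 Edu.2.2)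
    (hexG : ∀ (P : SplitConsts) (R : RenConsts), P.WF → R.WF2 →
      ∃ e : (ℝ × ℝ × ℝ) × (EngConsts → ℝ → ℝ) × ℝ, IsGridLitPkg R e ∧ TwoLegGridMomentsStepCT P R (klEngQ7 P R) klEngGeo14 e.1 e.2.1 e.2.2) :
    ∀ (P : SplitConsts) (R : RenConsts) (c : ℝ), P.WF → R.WF2 → 0 < c → c ≤ klEngC₃7GU klEngGeo14 P R →
      ∀ μ ∈ klWindowC, ∀ U : ℝ, 0 < U → U ≤ klEngU₀12GQ klEngGeo14 (klEngQ9dG klEngGeo14 P R) P R c → ∀ β : ℝ, klBetaMin ≤ β → β ≤ Real.exp (c / U ^ 2) →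
        ∀ (L M : ℕ) [NeZero L] [NeZero M], klEngL₄ P R β U ≤ L → klEngM₃ β U L ≤ M →
          ∀ n : ℕ, 1 ≤ n → n ≤ nScales β + 1 → IsKLRegime U c (-(n : ℤ)) →
            HistP klPredsV17F2 L M klEngGeo14 P (klEngQ9dG klEngGeo14 P R) R β U μ 0 n →
              (∀ m, 1 ≤ m → m < n → FlowPieceOscAt L M (klReadOscC P R) β U μ m) →
              FrameOK R U (nScales β) μ (klFlowFrameU L M β U μ n) →
                (∀ j ≤ n, LevelsUExportMixedAt L M (klCU2 P R (klEngQ7 P R)) P β U μ j) →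
                  KernelNormsV4 L M P (klEngQ9dG klEngGeo14 P R) β U μ (klFlowFrameU L M β U μ n) n ∧
                    (∀ j ≤ n, (KernelNormsLevels L M P (klEngQ9dG klEngGeo14 P R) β U μ (klFlowFrameU L M β U μ n) j ∧
                      KernelNormsWt4 L M (klWtBudget P (klEngQ9dG klEngGeo14 P R) U j) β U μ (klFlowFrameU L M β U μ n) j)) ∧
                    EngineFirstMoments L M klEngGeo14 P (klEngQ9dG klEngGeo14 P R) β U μ (klFlowFrameU L M β U μ n) n ∧
                    IsoFirstMomentsAt L M klIsoMomC (klIsoMomD P R) P β U μ n ∧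
                    TwoLegGridFlowMomentsAtC L M (klZtG klEngGeo14 P R) (klZs1G klEngGeo14 P R) (klZs2G klEngGeo14 P R) c β U μ n :=
  stub_engine_step_norms_of_producers_GQd klEngGeo14 klEngGeo14_wf hexT hexI hexG

end Summit.HubbardSuperconductivity.HubbardSuperconductivity.Theorems.EngineV8.A24a1G14

end
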